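import Summits.BirchSwinnertonDyer.Rank1Residual.GaloisImage.SelmerPairPairing
import HarnessLib

/-!
# The PAIR-COUNTING form of Poitou–Tate duality for Selmer structures `𝓕 ≤ 𝓖`:
# `#H¹_𝓖 · #H¹_{𝓕*} · ∏_{v∈T} #𝓕_v = #H¹_𝓕 · #H¹_{𝓖*} · ∏_{v∈T} #𝓖_v`
# (cell `b2b-bsdres`, team n1011, row T-a3-F1 core rank, item CR1 of skel/T-a3-F1-CR.md — route (G2))

Honest framing of the cell: research route; theorems (and four bookkeeping definitions with
bodies); no named fact is minted; CONDITIONAL on the three properties `IsPerfect`,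
`SumLocalTermEqZero`, `SelmerComplement` of a family of local invariant maps `inv` — in the tree
the content of the cited fact `poitouTate_selmerStructure_duality K` (Howard 2004 Thm. 2.1.11 ⟸
Milne ADT I Thm. 4.10) — taken as hypotheses.

## Statement

`K` a number field, `M` a finite discrete `Γ_K`-module killed by `n`, `T` a finite set of finite
places, `S(T) = {all infinite places} ∪ T` (`finSupport T`), `𝓕 ≤ 𝓖` two Selmer structures on `M`
unramified outside `S(T)` and EQUAL at the infinite places, `M` unramified and `n` a unit outside
`S(T)`.  Then (`card_selmerGroup_pair`)

  `#H¹_𝓖(K,M) · #H¹_{𝓕*}(K,M^D) · ∏_{v ∈ T} #𝓕_v = #H¹_𝓕(K,M) · #H¹_{𝓖*}(K,M^D) · ∏_{v ∈ T} #𝓖_v`,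

i.e. `χ(𝓖) − χ(𝓕) = ∑_{v ∈ T} (log #𝓖_v − log #𝓕_v)` for `χ(𝓛) := log #H¹_𝓛 − log #H¹_{𝓛*}` — the
relative form of the Greenberg–Wiles / DDT Thm. 2.19 Euler-characteristic formula, which is all
that Sakamoto's core-rank hypothesis needs (compare `𝓕_can` with the self-dual Kummer structure).
The tree's `poitouTate_selmerStructure_duality` deliberately types only the EXACTNESS statements
(its docstring: "Not included: the counting form"); this file derives the counting form from them
by finite group theory (X11b's `PerfectPairingAnnihilators`: `#A'^⊥ · #A' = #B`).

## Proof

With `A = ⊕_{v∈T} H¹(K_v, M)`, `B = ⊕_{v∈T} H¹(K_v, M^D)`, `b(t,u) = ∑_v inv_v(t_v ∪ u_v)` (perfect: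
`piPairing_flip_bijective`), `F = ∏ 𝓕_v`, `G = ∏ 𝓖_v ≤ A`, `I = loc_T(H¹_𝓖) + F`,
`J = loc_T(H¹_{𝓕*}) + G^*`:  (1) `#H¹_𝓖 · #F = #H¹_𝓕 · #I` (the map `H¹_𝓖 × F → I`,
`(x,t) ↦ loc x + t`, is onto with kernel `≅ H¹_𝓕`; `card_selmerGroup_mul_card_piCond`), and dually
`#H¹_{𝓕*} · #G^* = #H¹_{𝓖*} · #J`; (2) `I^⊥ = J` (`annRight_map_locPi_sup`: `⊇` is the Poitou–Tate
vanishing `SumLocalTermEqZero`, `⊆` is `SelmerComplement` (ii)); `F^⊥ = F^*`, `G^⊥ = G^*`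
(`annRight_piCond`, the definition of the dual local conditions); (3) `#I^⊥ · #I = #B = #G^* · #G`
(`natCard_annRight_mul`), and multiply.

References: B. Howard, Compos. Math. 140 (2004) Thm. 2.1.11; Milne, ADT I Thm. 4.10; H. Darmon,
F. Diamond, R. Taylor, *Fermat's Last Theorem* (1997) Thm. 2.19; B. Mazur, K. Rubin, Mem. AMS 799
(2004) Prop. 2.3.5.
-/
noncomputable section

open scoped Classical NumberField
open Function NumberField IsDedekindDomain
open Literature.NumberTheory.GaloisRepresentations Literature.NumberTheory.GaloisRepresentations.DiscreteGaloisModule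
  Literature.NumberTheory.GaloisCohomology
open Summit.BirchSwinnertonDyer.Rank1Residual.X11b.FiniteDuality

universe u

namespace Summit.BirchSwinnertonDyer.Rank1Residual.GaloisImage

variable {K : Type u} [Field K] [NumberField K] {n : ℕ}
variable {M : Type u} [AddCommGroup M] [TopologicalSpace M] [DiscreteTopology M] [Finite M]

variable (ρ : DiscreteGaloisModule K M) (T : Finset (HeightOneSpectrum (𝓞 K))) (inv : LocalInvariants K n)

/-! ### Step (1): `#H¹_𝓖 · #∏𝓕_v = #H¹_𝓕 · #(loc_T H¹_𝓖 + ∏𝓕_v)` -/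

omit [Finite M] in
/-- **Counting the relaxation `𝓕 ≤ 𝓖` supported on `T`.**  If `𝓕 ≤ 𝓖` agree at every place not
of the form `v ∈ T`, then `#H¹_𝓖(K,M) · #∏_{v∈T} 𝓕_v = #H¹_𝓕(K,M) · #(loc_T(H¹_𝓖) + ∏_{v∈T} 𝓕_v)`:
the map `H¹_𝓖 × ∏𝓕_v → ⊕_T H¹(K_v,M)`, `(x, t) ↦ loc_T x + t`, has image `loc_T(H¹_𝓖) + ∏ 𝓕_v`
and kernel `≅ {x ∈ H¹_𝓖 | loc_T x ∈ ∏ 𝓕_v} = H¹_𝓕`. [folklore] -/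
theorem card_selmerGroup_mul_card_piCond [Finite M] {𝓕 𝓖 : SelmerStructure ρ} (hle : 𝓕 ≤ 𝓖)
    (hout : ∀ v : Place K, (∀ w ∈ T, v ≠ Sum.inr w) → 𝓕 v = 𝓖 v) :
    Nat.card 𝓖.selmerGroup * Nat.card (piCond ρ T 𝓕) =
      Nat.card 𝓕.selmerGroup * Nat.card ↥((𝓖.selmerGroup.map (locPi ρ T)) ⊔ piCond ρ T 𝓕) := by
  -- the map `φ (x, t) = loc_T x + t` on `H¹_𝓖 × ∏ 𝓕_v`
  let φ : 𝓖.selmerGroup × piCond ρ T 𝓕 →+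
      (Π v : T, galoisCohomology (ρ.toLocal (Sum.inr v.1)) 1) :=
    (locPi ρ T).comp ((AddSubgroup.subtype _).comp (AddMonoidHom.fst _ _)) +
      (AddSubgroup.subtype _).comp (AddMonoidHom.snd _ _)
  have hφ : ∀ x t, φ (x, t) = locPi ρ T x + t := fun x t => rfl
  -- its range
  have hrange : φ.range = (𝓖.selmerGroup.map (locPi ρ T)) ⊔ piCond ρ T 𝓕 := by
    ext s
    simp only [AddMonoidHom.mem_range, AddSubgroup.mem_sup, AddSubgroup.mem_map, Prod.exists, hφ]
    constructor
    · rintro ⟨x, t, rfl⟩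
      exact ⟨locPi ρ T x, ⟨x, x.2, rfl⟩, t, t.2, rfl⟩
    · rintro ⟨_, ⟨x, hx, rfl⟩, t, ht, rfl⟩
      exact ⟨⟨x, hx⟩, ⟨t, ht⟩, rfl⟩
  -- its kernel is `H¹_𝓕`
  have hkermem : ∀ x : 𝓖.selmerGroup, -locPi ρ T x ∈ piCond ρ T 𝓕 ↔ (x : galoisCohomology ρ 1) ∈ 𝓕.selmerGroup := by
    intro x
    rw [neg_mem_iff, mem_piCond_iff, SelmerStructure.mem_selmerGroup_iff]
    constructor
    · intro h v
      by_cases hv : ∀ w ∈ T, v ≠ Sum.inr w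
      · rw [hout v hv]; exact (SelmerStructure.mem_selmerGroup_iff _ _).mp x.2 v
      · push Not at hv
        obtain ⟨w, hw, rfl⟩ := hv
        exact h ⟨w, hw⟩
    · intro h v
      exact h (Sum.inr v.1)
  have hmono : ∀ x ∈ 𝓕.selmerGroup, x ∈ 𝓖.selmerGroup := fun x hx =>
    (SelmerStructure.mem_selmerGroup_iff _ _).mpr fun v =>
      hle v ((SelmerStructure.mem_selmerGroup_iff _ _).mp hx v)
  let e : 𝓕.selmerGroup ≃ φ.ker :=
    { toFun := fun x => ⟨(⟨x.1, hmono x.1 x.2⟩,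
        ⟨-locPi ρ T x.1, (hkermem ⟨x.1, hmono x.1 x.2⟩).mpr x.2⟩), by
          rw [AddMonoidHom.mem_ker, hφ]; exact add_neg_cancel _⟩
      invFun := fun y => ⟨(y.1.1 : galoisCohomology ρ 1), by
        have hy := y.2
        rw [AddMonoidHom.mem_ker, hφ, add_eq_zero_iff_neg_eq] at hy
        have : -locPi ρ T y.1.1 ∈ piCond ρ T 𝓕 := by rw [hy]; exact y.1.2.2
        exact (hkermem y.1.1).mp this⟩
      left_inv := fun x => rfl
      right_inv := fun y => by
        have hy := y.2
        rw [AddMonoidHom.mem_ker, hφ, add_eq_zero_iff_neg_eq] at hy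
        apply Subtype.ext
        apply Prod.ext
        · rfl
        · exact Subtype.ext (by simpa using hy) }
  have h1 : Nat.card φ.ker * φ.ker.index = Nat.card (𝓖.selmerGroup × piCond ρ T 𝓕) :=
    AddSubgroup.card_mul_index _
  rw [Nat.card_prod, AddSubgroup.index_ker, ← Nat.card_congr e, hrange] at h1
  rw [← h1]

/-! ### Step (2): `(loc_T H¹_𝓖 + ∏𝓕_v)^⊥ = loc_T H¹_{𝓕*} + ∏𝓖_v^*` (Poitou–Tate) -/

/-- **Exact annihilators (Howard Thm. 2.1.11 / Milne I 4.10 in the pair form).**  For `𝓕 ≤ 𝓖`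
unramified outside `S(T)`, equal at the infinite places, `M` killed by `n`, unramified with `n` a
unit outside `S(T)`:  `(loc_T(H¹_𝓖) + ∏_{v∈T} 𝓕_v)^⊥ = loc_T(H¹_{𝓕*}) + ∏_{v∈T} 𝓖_v^*` under the
summed local pairing — `⊇` from the Poitou–Tate vanishing (`SumLocalTermEqZero`), `⊆` from
`SelmerComplement` (ii). [folklore] -/
theorem annRight_map_locPi_sup (hsum : inv.SumLocalTermEqZero) (hcompl : inv.SelmerComplement)
    (hM : ∀ m : M, n • m = 0)
    (hS : ∀ v : HeightOneSpectrum (𝓞 K), v ∉ T → ((n : ℕ) : 𝓞 K) ∉ v.asIdeal ∧ GaloisRep.IsUnramifiedAt v ρ)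
    {𝓕 𝓖 : SelmerStructure ρ} (hle : 𝓕 ≤ 𝓖) (h𝓕 : 𝓕.IsUnramifiedOutside (finSupport T))
    (h𝓖 : 𝓖.IsUnramifiedOutside (finSupport T))
    (hinf : ∀ w : InfinitePlace K, 𝓕 (Sum.inl w) = 𝓖 (Sum.inl w)) :
    annRight (piPairing ρ T inv) ((𝓖.selmerGroup.map (locPi ρ T)) ⊔ piCond ρ T 𝓕) =
      ((inv.dualSelmerStructure ρ 𝓕).selmerGroup.map (locPi (ρ.tateDual n) T)) ⊔
        piCond (ρ.tateDual n) T (inv.dualSelmerStructure ρ 𝓖) := by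
  have hout : ∀ v ∉ finSupport T, 𝓖 v ≤ 𝓕 v := by
    intro v hv
    rcases v with w | w
    · exact absurd (inl_mem_finSupport T w) hv
    · rw [inr_mem_finSupport_iff] at hv
      rw [h𝓕.2 w (by simpa using hv), h𝓖.2 w (by simpa using hv)]
  apply le_antisymm
  · -- `⊆`: SelmerComplement (ii)
    intro u hu
    rw [mem_annRight_iff] at hu
    -- `u ∈ ∏ 𝓕_v^*`
    have huF : u ∈ piCond (ρ.tateDual n) T (inv.dualSelmerStructure ρ 𝓕) := by
      rw [← annRight_piCond ρ T inv 𝓕, mem_annRight_iff]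
      exact fun t ht => hu t (AddSubgroup.mem_sup_right ht)
    -- extend `u` by zero to all places
    let u' : Π v : Place K, galoisCohomology ((ρ.tateDual n).toLocal v) 1 := fun v =>
      match v with
      | Sum.inl _ => 0
      | Sum.inr w => if hw : w ∈ T then u ⟨w, hw⟩ else 0
    have hu'inr : ∀ w (hw : w ∈ T), u' (Sum.inr w) = u ⟨w, hw⟩ := fun w hw => by
      simp only [u', dif_pos hw]
    have hu'S : ∀ v ∈ finSupport T, u' v ∈ inv.dualSelmerStructure ρ 𝓕 v := by
      intro v hv
      rcases v with w | w
      · exact zero_mem _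
      · rw [inr_mem_finSupport_iff] at hv
        rw [hu'inr w hv]
        exact (mem_piCond_iff _ T _ u).mp huF ⟨w, hv⟩
    have hu'orth : ∀ x ∈ 𝓖.selmerGroup,
        ∑ v ∈ finSupport T, localTatePairingZMod ρ n v (inv v)
          (galoisCohomology.localization ρ v 1 x) (u' v) = 0 := by
      intro x hx
      rw [sum_finSupport]
      have h0 : ∑ w : InfinitePlace K, localTatePairingZMod ρ n (Sum.inl w) (inv (Sum.inl w))
          (galoisCohomology.localization ρ (Sum.inl w) 1 x) (u' (Sum.inl w)) = 0 :=
        Finset.sum_eq_zero fun w _ => by simp only [u', map_zero]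
      rw [h0, zero_add]
      have := hu (locPi ρ T x) (AddSubgroup.mem_sup_left ⟨x, hx, rfl⟩)
      rw [piPairing_apply] at this
      rw [← this, ← Finset.sum_coe_sort T]
      exact Finset.sum_congr rfl fun w _ => by rw [hu'inr w.1 w.2, locPi_apply]
    obtain ⟨y, hy, hyu⟩ := (hcompl ρ hM (finSupport T) (fun v hv => hS v (by simpa using hv))
      𝓕 𝓖 hle h𝓕 h𝓖).2 u' hu'S hu'orth
    -- `u = loc_T y - g` with `g ∈ ∏ 𝓖_v^*`
    rw [AddSubgroup.mem_sup]
    refine ⟨locPi (ρ.tateDual n) T y, ⟨y, hy, rfl⟩, u - locPi (ρ.tateDual n) T y, ?_, by abel⟩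
    rw [mem_piCond_iff]
    intro w
    have := hyu (Sum.inr w.1) ((inr_mem_finSupport_iff T w.1).mpr w.2)
    rw [hu'inr w.1 w.2] at this
    rw [Pi.sub_apply, locPi_apply, ← neg_sub, neg_mem_iff]
    exact this
  · -- `⊇`: the Poitou–Tate vanishing and the definition of the dual conditions
    apply sup_le
    · rintro _ ⟨y, hy, rfl⟩
      rw [mem_annRight_iff]
      intro s hs
      rw [AddSubgroup.mem_sup] at hs
      obtain ⟨_, ⟨x, hx, rfl⟩, t, ht, rfl⟩ := hs
      rw [map_add, AddMonoidHom.add_apply]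
      have h1 : piPairing ρ T inv (locPi ρ T x) (locPi (ρ.tateDual n) T y) = 0 := by
        have hvan := hsum.sum_localTerm_selmer_eq_zero ρ hM (S := finSupport T) hout hx hy
        rw [sum_finSupport] at hvan
        have h0 : ∑ w : InfinitePlace K, inv.localTerm ρ (Sum.inl w) x y = 0 :=
          Finset.sum_eq_zero fun w _ =>
            inv.localTerm_eq_zero_of_mem_of_mem_dual ρ (Sum.inl w) (𝓕 (Sum.inl w))
              (by rw [hinf w]; exact (SelmerStructure.mem_selmerGroup_iff _ _).mp hx _)
              ((SelmerStructure.mem_selmerGroup_iff _ _).mp hy _)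
        rw [h0, zero_add] at hvan
        rw [piPairing_apply, ← hvan, ← Finset.sum_coe_sort T]
        exact Finset.sum_congr rfl fun w _ => by rw [locPi_apply, locPi_apply, LocalInvariants.localTerm_apply]; rfl
      have h2 : piPairing ρ T inv t (locPi (ρ.tateDual n) T y) = 0 := by
        rw [piPairing_apply]
        refine Finset.sum_eq_zero fun w _ => ?_
        have hyw := (SelmerStructure.mem_selmerGroup_iff _ _).mp hy (Sum.inr w.1)
        rw [LocalInvariants.dualSelmerStructure_apply, LocalInvariants.mem_dualLocalCondition_iff] at hyw
        rw [locPi_apply]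
        exact hyw _ ((mem_piCond_iff ρ T 𝓕 t).mp ht w)
      rw [h1, h2, add_zero]
    · rw [← annRight_piCond ρ T inv 𝓖]
      exact annRight_anti _ (sup_le (AddSubgroup.map_le_iff_le_comap.mpr fun x hx => by
        rw [AddSubgroup.mem_comap, mem_piCond_iff]
        exact fun w => (SelmerStructure.mem_selmerGroup_iff _ _).mp hx _) (piCond_mono ρ T hle))

/-! ### Step (3): the pair-counting identity -/

/-- **The pair-counting form of Poitou–Tate duality** (relative Greenberg–Wiles formula): for
Selmer structures `𝓕 ≤ 𝓖` on a finite `Γ_K`-module `M` killed by `n`, both unramified outside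
`S(T) = ∞ ∪ T`, equal at the infinite places, with `M` unramified and `n` a unit outside `S(T)`,
and a Poitou–Tate family `inv` (`IsPerfect`, `SumLocalTermEqZero`, `SelmerComplement`):
`#H¹_𝓖(K,M) · #H¹_{𝓕*}(K,M^D) · ∏_{v∈T} #𝓕_v = #H¹_𝓕(K,M) · #H¹_{𝓖*}(K,M^D) · ∏_{v∈T} #𝓖_v`.
[folklore] -/
theorem card_selmerGroup_pair [NeZero n] (hperf : inv.IsPerfect) (hsum : inv.SumLocalTermEqZero)
    (hcompl : inv.SelmerComplement) (hM : ∀ m : M, n • m = 0)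
    (hS : ∀ v : HeightOneSpectrum (𝓞 K), v ∉ T → ((n : ℕ) : 𝓞 K) ∉ v.asIdeal ∧ GaloisRep.IsUnramifiedAt v ρ)
    {𝓕 𝓖 : SelmerStructure ρ} (hle : 𝓕 ≤ 𝓖) (h𝓕 : 𝓕.IsUnramifiedOutside (finSupport T))
    (h𝓖 : 𝓖.IsUnramifiedOutside (finSupport T))
    (hinf : ∀ w : InfinitePlace K, 𝓕 (Sum.inl w) = 𝓖 (Sum.inl w)) :
    Nat.card 𝓖.selmerGroup * Nat.card (inv.dualSelmerStructure ρ 𝓕).selmerGroup *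
        ∏ v ∈ T, Nat.card (𝓕 (Sum.inr v)) =
      Nat.card 𝓕.selmerGroup * Nat.card (inv.dualSelmerStructure ρ 𝓖).selmerGroup *
        ∏ v ∈ T, Nat.card (𝓖 (Sum.inr v)) := by
  haveI : Finite (TateDual K M n) := DiscreteGaloisModule.TateDual.finite (K := K) (M := M) n
  -- places off `T`
  have houtT : ∀ v : Place K, (∀ w ∈ T, v ≠ Sum.inr w) → 𝓕 v = 𝓖 v := by
    intro v hv
    rcases v with w | w
    · exact hinf w
    · have hw : w ∉ T := fun h => hv w h rfl
      rw [h𝓕.2 w (by simpa using hw), h𝓖.2 w (by simpa using hw)]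
  -- the dual structures: `𝓖* ≤ 𝓕*`, unramified outside `S(T)`, equal at infinite places
  have hle' : inv.dualSelmerStructure ρ 𝓖 ≤ inv.dualSelmerStructure ρ 𝓕 :=
    inv.dualSelmerStructure_anti ρ hle
  have houtT' : ∀ v : Place K, (∀ w ∈ T, v ≠ Sum.inr w) →
      inv.dualSelmerStructure ρ 𝓖 v = inv.dualSelmerStructure ρ 𝓕 v := by
    intro v hv
    rw [LocalInvariants.dualSelmerStructure_apply, LocalInvariants.dualSelmerStructure_apply, houtT v hv]
  -- (1) and its dual
  have h1 := card_selmerGroup_mul_card_piCond ρ T hle houtT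
  have h1' := card_selmerGroup_mul_card_piCond (ρ.tateDual n) T hle' houtT'
  -- (2)
  have h2 := annRight_map_locPi_sup ρ T inv hsum hcompl hM hS hle h𝓕 h𝓖 hinf
  -- (3) counting with the perfect pairing
  have hflip := piPairing_flip_bijective ρ T inv hperf hM
  have hA := nsmul_pi_galoisCohomology_eq_zero ρ T hM
  have h3 := natCard_annRight_mul hA (piPairing ρ T inv) hflip
    ((𝓖.selmerGroup.map (locPi ρ T)) ⊔ piCond ρ T 𝓕)
  rw [h2] at h3
  have h4 := natCard_annRight_mul hA (piPairing ρ T inv) hflip (piCond ρ T 𝓖)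
  rw [annRight_piCond] at h4
  -- assemble: all in `ℕ`, cancel the positive factor `#∏𝓖_v^* · #(loc H¹_𝓖 + ∏𝓕_v)`
  rw [← card_piCond ρ T 𝓕, ← card_piCond ρ T 𝓖]
  have hIpos : 0 < Nat.card ↥((𝓖.selmerGroup.map (locPi ρ T)) ⊔ piCond ρ T 𝓕) := Nat.card_pos
  have hGpos : 0 < Nat.card (piCond (ρ.tateDual n) T (inv.dualSelmerStructure ρ 𝓖)) := Nat.card_pos
  -- `#Sel𝓖 · #F = #Sel𝓕 · #I`, `#Sel𝓕* · #G* = #Sel𝓖* · #J`, `#J · #I = #G* · #G`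
  have key : Nat.card 𝓖.selmerGroup * Nat.card (inv.dualSelmerStructure ρ 𝓕).selmerGroup *
      Nat.card (piCond ρ T 𝓕) *
      (Nat.card (piCond (ρ.tateDual n) T (inv.dualSelmerStructure ρ 𝓖)) *
        Nat.card ↥((𝓖.selmerGroup.map (locPi ρ T)) ⊔ piCond ρ T 𝓕)) =
      Nat.card 𝓕.selmerGroup * Nat.card (inv.dualSelmerStructure ρ 𝓖).selmerGroup *
      Nat.card (piCond ρ T 𝓖) *
      (Nat.card (piCond (ρ.tateDual n) T (inv.dualSelmerStructure ρ 𝓖)) *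
        Nat.card ↥((𝓖.selmerGroup.map (locPi ρ T)) ⊔ piCond ρ T 𝓕)) := by
    calc _ = (Nat.card 𝓖.selmerGroup * Nat.card (piCond ρ T 𝓕)) *
          (Nat.card (inv.dualSelmerStructure ρ 𝓕).selmerGroup *
            Nat.card (piCond (ρ.tateDual n) T (inv.dualSelmerStructure ρ 𝓖))) *
          Nat.card ↥((𝓖.selmerGroup.map (locPi ρ T)) ⊔ piCond ρ T 𝓕) := by ring
      _ = (Nat.card 𝓕.selmerGroup * Nat.card ↥((𝓖.selmerGroup.map (locPi ρ T)) ⊔ piCond ρ T 𝓕)) *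
          (Nat.card (inv.dualSelmerStructure ρ 𝓖).selmerGroup *
            Nat.card ↥(((inv.dualSelmerStructure ρ 𝓕).selmerGroup.map (locPi (ρ.tateDual n) T)) ⊔
              piCond (ρ.tateDual n) T (inv.dualSelmerStructure ρ 𝓖))) *
          Nat.card ↥((𝓖.selmerGroup.map (locPi ρ T)) ⊔ piCond ρ T 𝓕) := by rw [h1, h1']
      _ = Nat.card 𝓕.selmerGroup * Nat.card (inv.dualSelmerStructure ρ 𝓖).selmerGroup *
          (Nat.card ↥(((inv.dualSelmerStructure ρ 𝓕).selmerGroup.map (locPi (ρ.tateDual n) T)) ⊔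
              piCond (ρ.tateDual n) T (inv.dualSelmerStructure ρ 𝓖)) *
            Nat.card ↥((𝓖.selmerGroup.map (locPi ρ T)) ⊔ piCond ρ T 𝓕)) *
          Nat.card ↥((𝓖.selmerGroup.map (locPi ρ T)) ⊔ piCond ρ T 𝓕) := by ring
      _ = Nat.card 𝓕.selmerGroup * Nat.card (inv.dualSelmerStructure ρ 𝓖).selmerGroup *
          (Nat.card (piCond (ρ.tateDual n) T (inv.dualSelmerStructure ρ 𝓖)) *
            Nat.card (piCond ρ T 𝓖)) *
          Nat.card ↥((𝓖.selmerGroup.map (locPi ρ T)) ⊔ piCond ρ T 𝓕) := by rw [h3, h4]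
      _ = _ := by ring
  exact Nat.eq_of_mul_eq_mul_right (Nat.mul_pos hGpos hIpos) key

end Summit.BirchSwinnertonDyer.Rank1Residual.GaloisImage

end
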